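import Mathlib

/-!
# The Eisenstein-class recipe at eight composite levels, and three levels where it must fail (solo-blind, s25; hodge.md §8.18)

Companion to `SoloBlindEisensteinClass` (levels 34, 39; control 26), same dictionary: `D₁(N)` = `ℚ ⊗`
cyclotomic numbers of level `N`, generators `u_n` (`u_0 = 0`), relations = evenness + non-degenerate
distribution relations (Bass); the weight-2 depth-2 dihedral cobracket has image
`span{T(a,b,c) = u_a∧u_b + u_b∧u_c + u_c∧u_a : a+b+c ≡ 0 (mod N)}` (Goncharov); `k(N) = dim coker`.

THE RECIPE (hodge §8.18.1).  For `N = p·d`, `p` prime, `p ∤ d`, and an even Dirichlet character `ε mod p`: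
`E(n) = ε(n/d)·[d ∣ n, p ∤ n]`, `J(n) = [d ∣ n, p ∤ n]`, `Φ = E ∧ J`.  The paper theorem: `E` is well
defined on `D₁(N)` iff `ε(q) = 1` for every prime `q ∣ d`, and then `Φ` is a non-zero cokernel class, so
`k(N) ≥ #{such ε ≠ 1}`.  Here this is certified by the kernel (`decide +kernel`, no `native_decide`), with
`ε = χ_p` the Legendre symbol given by an explicit table of squares, at

* `N = 55 = 5·11`, `68 = 17·4`, `82 = 41·2`, `95 = 5·19`, `111 = 37·3`, `117 = 13·9` — including the two
  cases `d = 4`, `d = 9` where `d` is a prime power (the `q^e`-branch of the proof) — : `E`, `J` even, zero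
  at `0`, respecting every non-degenerate distribution relation for every prime `q ∣ N`; `Φ` kills all
  three-term tensors; `Φ(d, m·d) = 2` for the least non-residue `m`.  Hence, granting the dictionary,
  `k(55), k(68), k(82), k(95), k(111), k(117) ≥ 1` (exact values found by computation: 2, 1, 1, ≥1, ≥1, ≥1;
  hodge §8.18.3);
* and the recipe FAILS (the function `E` violates a distribution relation) at `N = 35 = 5·7`
  (`χ₅(7) = −1`), `N = 51 = 17·3` (`χ₁₇(3) = −1`) and at `N = 65` for BOTH factorizations
  (`χ₁₃(5) = −1`, `χ₅(13) = −1`) — so the eight cokernel classes observed at level 65 (hodge §8.18.4) do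
  not come from quadratic Eisenstein classes: a second mechanism.
-/

namespace Summit.KontsevichZagierPeriods.KontsevichZagierPeriods.Theorems.SoloBlindEisensteinClassFamily

/-- `f` (a function of residues `0 ≤ n < N`) is even: `f(−n) = f(n)`. -/
def IsEven (N : ℕ) (f : ℕ → ℤ) : Prop := ∀ n < N, f ((N - n) % N) = f n

/-- `f` respects the non-degenerate distribution relations of level `N` for the prime `q ∣ N`. -/
def RespectsDist (N q : ℕ) (f : ℕ → ℤ) : Prop :=
  ∀ n < N, (q * n) % N ≠ 0 →
    ((List.range q).map (fun t => f ((n + t * (N / q)) % N))).sum = f ((q * n) % N)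

/-- The wedge `E ∧ J` as an antisymmetric kernel on pairs of residues. -/
def wedge (E J : ℕ → ℤ) (a b : ℕ) : ℤ := E a * J b - J a * E b

/-- `Φ` kills every cyclic three-term tensor `T(a,b,c)`, `a + b + c ≡ 0 (mod N)`. -/
def KillsThreeTerm (N : ℕ) (Φ : ℕ → ℕ → ℤ) : Prop :=
  ∀ a < N, ∀ b < N,
    Φ a b + Φ b ((2 * N - a - b) % N) + Φ ((2 * N - a - b) % N) a = 0

/-- A quadratic character mod `p` from its list of non-zero squares. -/
def chiTab (p : ℕ) (squares : List ℕ) (m : ℕ) : ℤ :=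
  if m % p = 0 then 0 else if m % p ∈ squares then 1 else -1

/-- Legendre symbol mod 5 (squares 1, 4). -/
def chi5 : ℕ → ℤ := chiTab 5 [1, 4]
/-- Legendre symbol mod 13 (table of squares). -/
def chi13 : ℕ → ℤ := chiTab 13 [1, 3, 4, 9, 10, 12]
/-- Legendre symbol mod 17 (table of squares). -/
def chi17 : ℕ → ℤ := chiTab 17 [1, 2, 4, 8, 9, 13, 15, 16]
/-- Legendre symbol mod 37 (table of squares). -/
def chi37 : ℕ → ℤ := chiTab 37 [1, 3, 4, 7, 9, 10, 11, 12, 16, 21, 25, 26, 27, 28, 30, 33, 34, 36]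
/-- Legendre symbol mod 41 (table of squares). -/
def chi41 : ℕ → ℤ := chiTab 41 [1, 2, 4, 5, 8, 9, 10, 16, 18, 20, 21, 23, 25, 31, 32, 33, 36, 37, 39, 40]

/-- The recipe: `E(n) = χ(n/d)` on `{d ∣ n, p ∤ n}`, else 0 (for `0 ≤ n < p·d`, `n/d` is the residue `n·d⁻¹ mod p`). -/
def Erec (p d : ℕ) (χ : ℕ → ℤ) (n : ℕ) : ℤ := if n % d = 0 ∧ n % p ≠ 0 then χ (n / d) else 0
/-- The recipe: `J(n) = 1` on `{d ∣ n, p ∤ n}`, else 0. -/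
def Jrec (p d : ℕ) (n : ℕ) : ℤ := if n % d = 0 ∧ n % p ≠ 0 then 1 else 0

/-- The full certificate at level `N = p·d` with prime divisors `q₁, q₂` of `N` and non-vanishing witness `(d, m·d)`. -/
def Certificate (N p d q₁ q₂ m : ℕ) (χ : ℕ → ℤ) : Prop :=
  Erec p d χ 0 = 0 ∧ Jrec p d 0 = 0 ∧ IsEven N (Erec p d χ) ∧ IsEven N (Jrec p d) ∧
  RespectsDist N q₁ (Erec p d χ) ∧ RespectsDist N q₂ (Erec p d χ) ∧
  RespectsDist N q₁ (Jrec p d) ∧ RespectsDist N q₂ (Jrec p d) ∧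
  KillsThreeTerm N (wedge (Erec p d χ) (Jrec p d)) ∧ wedge (Erec p d χ) (Jrec p d) d (m * d) = 2

/-- Level 55 = 5·11, `ε = χ₅` (`χ₅(11) = 1`). -/
theorem certificate55 : Certificate 55 5 11 5 11 2 chi5 := by
  unfold Certificate IsEven RespectsDist KillsThreeTerm; decide +kernel

/-- Level 68 = 17·4, `ε = χ₁₇` (`χ₁₇(2) = 1`; `d = 4` is a prime power). -/
theorem certificate68 : Certificate 68 17 4 2 17 3 chi17 := by
  unfold Certificate IsEven RespectsDist KillsThreeTerm; decide +kernel

/-- Level 82 = 41·2, `ε = χ₄₁` (`χ₄₁(2) = 1`). -/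
theorem certificate82 : Certificate 82 41 2 2 41 3 chi41 := by
  unfold Certificate IsEven RespectsDist KillsThreeTerm; decide +kernel

/-- Level 95 = 5·19, `ε = χ₅` (`χ₅(19) = 1`). -/
theorem certificate95 : Certificate 95 5 19 5 19 2 chi5 := by
  unfold Certificate IsEven RespectsDist KillsThreeTerm; decide +kernel

/-- Level 111 = 37·3, `ε = χ₃₇` (`χ₃₇(3) = 1`). -/
theorem certificate111 : Certificate 111 37 3 3 37 2 chi37 := by
  unfold Certificate IsEven RespectsDist KillsThreeTerm; decide +kernel

/-- Level 117 = 13·9, `ε = χ₁₃` (`χ₁₃(3) = 1`; `d = 9` is a prime power). -/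
theorem certificate117 : Certificate 117 13 9 3 13 2 chi13 := by
  unfold Certificate IsEven RespectsDist KillsThreeTerm; decide +kernel

/-- FAILURE at 35 = 5·7 (`χ₅(7) = −1`): `E` violates a distribution relation for `q = 7`. -/
theorem recipe_fails35 : ¬ RespectsDist 35 7 (Erec 5 7 chi5) := by
  unfold RespectsDist; decide +kernel

/-- FAILURE at 51 = 17·3 (`χ₁₇(3) = −1`). -/
theorem recipe_fails51 : ¬ RespectsDist 51 3 (Erec 17 3 chi17) := by
  unfold RespectsDist; decide +kernel

/-- FAILURE at 65 = 13·5 for `χ₁₃` (`χ₁₃(5) = −1`) and for `χ₅` with `65 = 5·13` (`χ₅(13) = −1`):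
neither quadratic Eisenstein class exists at level 65, although `k(65) = 8`. -/
theorem recipe_fails65 :
    ¬ RespectsDist 65 5 (Erec 13 5 chi13) ∧ ¬ RespectsDist 65 13 (Erec 5 13 chi5) := by
  unfold RespectsDist; decide +kernel

end Summit.KontsevichZagierPeriods.KontsevichZagierPeriods.Theorems.SoloBlindEisensteinClassFamily
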